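import Summits.HodgeConjecture.CorCM.GaloisQuaternionCyclicPrimeNormPairConverse
import Summits.HodgeConjecture.CorCM.GaloisQuaternionCyclicPrimeNormPairs
import Summits.HodgeConjecture.CorCM.GaloisQuaternionCyclicPrimeAllTypes
import HarnessLib

/-!
# `Q₈ × C_p`: every primitive CM type is nondegenerate **iff** `ℤ/p` has no `μ₄`-norm pair — the dichotomy criterion

COR-CM (cell `pub-hodgecm2`), binder seat b04 (gen 29), count-neutral claim QUATERNION-CYCLIC-PRIME-DEGENERATE, part V
(capstone of parts I–IV).  KERNEL ONLY: theorems; no definition, no named fact, no `sorry`.  `HC_CM` is neither used nor claimed: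
the Hodge conjecture for a NAMED CLASS of CM abelian varieties modulo ONE explicit, finite, combinatorial hypothesis on `p`,
together with the proof that the hypothesis is NECESSARY.

SETTING.  `K` a Galois CM field with `Gal(K/ℚ) ≅ Q₈ × C_p` (`p` an odd prime; complex conjugation `(a 2, 1)`).  A
`μ₄`-NORM PAIR of `Q₈ × C_p` is a pair of sheets `k₀, k₁ : ℤ/p → ℤ/4` for which, with `Mⱼ(d, r) = #{v : kⱼ(v) − kⱼ(d − v) = r}`,
`Σⱼ (Mⱼ(d,0) − Mⱼ(d,2))` and `Σⱼ (Mⱼ(d,1) − Mⱼ(d,3))` do not depend on `d` (equivalently `N(G₀) = −N(G₁)` for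
`Gⱼ = Σ_v i^{kⱼ(v)} ζ_p^v` and the norm `N` of `ℚ(ζ_p, i)/ℚ(ζ_p)`).

* **`forall_isNondegenerate_iff_forall_normPair_const`**: ALL PRIMITIVE CM TYPES OF `K` ARE NONDEGENERATE ⟺ every `μ₄`-norm pair
  of `Q₈ × C_p` has constant first sheet.  GOOD (theorem, part III) for `ord_p 2` odd (`p = 7, 23, 31, 47, 71, 73, 79, 89, …`);
  BAD by explicit pairs for `p = 3, 5, 11` (gens 20–24), `13, 17, 19` (part III), `37, 43, 61` (part III-B, this gen);
  open for the remaining `p` with `ord_p 2` even (the seat's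
  counting heuristic predicts GOOD for generic `p ≳ 100` in spite of the residue condition).
* `isNondegenerate_of_isPrimitive_quaternion_cyclic_of_forall_normPair_const`, `cmTypeRank_eq_…` (rank `4p + 1`),
  **`hodgeConjectureFor_pow_of_isSimple_quaternion_cyclic_of_forall_normPair_const`** (the HODGE CONJECTURE FOR ALL POWERS of
  every SIMPLE abelian `4p`-fold with CM by `K`, under the combinatorial hypothesis), `hodgeConjectureFor_of_isSimple_…`,
  `hodgeClassSpan_pow_eq_divisorClassesSpan_of_isSimple_…`.
* `isStablyNondegenerate_of_ringHom_quaternion_cyclic_of_forall_normPair_const`,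
  `hodgeConjectureFor_pow_quaternion_cyclic_of_forall_normPair_const`: ALL TYPES / all powers under the hypothesis (part III♯
  `…QuaternionCyclicPrimeAllTypes`);
* `forall_normPair_const_of_odd_orderOf_two`: conversely part III shows that for `ord_p 2` odd no such norm pair exists.

## References

* [Kubota1965] T. Kubota, *On the field extension by complex multiplication*, Trans. AMS 118 (1965), §2, §4 Lemma 2.
* [Shimura1998] G. Shimura, *Abelian Varieties with Complex Multiplication and Modular Functions*, §8.2 Prop. 26.
* [Gordon1999HodgeAVSurvey] B. B. Gordon, *A survey of the Hodge conjecture for abelian varieties*, Thm. 6.4, §9.3, §9.4.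
* [FeinGordonSmith1971] B. Fein, B. Gordon, J. H. Smith, J. Number Theory 3 (1971), 310–315.
-/

noncomputable section

open CategoryTheory CategoryTheory.Limits NumberField
open scoped BigOperators

namespace Summit.HodgeConjecture.CorCM.GaloisQuaternionCyclic

open Literature.NumberTheory.ComplexMultiplication
open Literature.AlgebraicGeometry Literature.AlgebraicGeometry.Motives Literature.AlgebraicGeometry.HodgeTheory
open Literature.AlgebraicGeometry.Motives.AbelianVariety
open Literature.AlgebraicGeometry.ComplexMultiplication
open Literature.AlgebraicGeometry.Pohlmann1968
open Summit.HodgeConjecture.CorCM.GaloisRank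
open QuaternionGroup

section Field

variable {p : ℕ} [Fact p.Prime]
variable {K : Type} [Field K] [NumberField K] [IsCMField K] [IsGalois ℚ K]

/-- **NO `μ₄`-NORM PAIR ⟹ EVERY PRIMITIVE CM TYPE IS NONDEGENERATE** (`Gal(K/ℚ) ≅ Q₈ × C_p`, `p` an odd prime): if every
pair of sheets `k₀, k₁ : ℤ/p → ℤ/4` satisfying the two balance identities of `CorCM/GaloisQuaternionCyclicPrimeNormPairs` has
`k₀` constant, then every PRIMITIVE CM type of `K` is NONDEGENERATE. [cite: Kubota1965, §4 Lemma 2]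
[cite: Shimura1998, §8.2 Prop. 26] -/
theorem isNondegenerate_of_isPrimitive_quaternion_cyclic_of_forall_normPair_const (hp2 : p ≠ 2)
    (hNP : ∀ k₀ k₁ : ZMod p → ZMod 4,
      (∀ d : ZMod p,
        (Finset.univ.filter fun v => k₀ v - k₀ (d - v) = 0).card +
              (Finset.univ.filter fun v => k₁ v - k₁ (d - v) = 0).card +
            (Finset.univ.filter fun v => k₀ v - k₀ (0 - v) = 2).card +
              (Finset.univ.filter fun v => k₁ v - k₁ (0 - v) = 2).card =
          (Finset.univ.filter fun v => k₀ v - k₀ (0 - v) = 0).card +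
                (Finset.univ.filter fun v => k₁ v - k₁ (0 - v) = 0).card +
              (Finset.univ.filter fun v => k₀ v - k₀ (d - v) = 2).card +
            (Finset.univ.filter fun v => k₁ v - k₁ (d - v) = 2).card) →
      (∀ d : ZMod p,
        (Finset.univ.filter fun v => k₀ v - k₀ (d - v) = 1).card +
              (Finset.univ.filter fun v => k₁ v - k₁ (d - v) = 1).card +
            (Finset.univ.filter fun v => k₀ v - k₀ (0 - v) = 3).card +
              (Finset.univ.filter fun v => k₁ v - k₁ (0 - v) = 3).card =
          (Finset.univ.filter fun v => k₀ v - k₀ (0 - v) = 1).card +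
                (Finset.univ.filter fun v => k₁ v - k₁ (0 - v) = 1).card +
              (Finset.univ.filter fun v => k₀ v - k₀ (d - v) = 3).card +
            (Finset.univ.filter fun v => k₁ v - k₁ (d - v) = 3).card) →
      ∀ v, k₀ v = k₀ 0)
    (e : (K ≃ₐ[ℚ] K) ≃* QuaternionGroup 2 × Multiplicative (ZMod p)) {Φ : CMType K} (φ₀ : K →+* ℂ)
    (hprim : IsPrimitive (ℂ ≃+* ℂ) Φ.1 φ₀) : IsNondegenerate Φ := by
  classical
  have hp : p.Prime := Fact.out
  haveI : NeZero p := ⟨hp.ne_zero⟩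
  have hc := map_complexConj_eq hp2 e
  set S : Finset (QuaternionGroup 2 × Multiplicative (ZMod p)) :=
    Finset.univ.filter fun y => embOf φ₀ (e.symm y) ∈ Φ.1 with hS_def
  have hS : ∀ y, y ∈ S ↔ embOf φ₀ (e.symm y) ∈ Φ.1 := fun y => by
    simp only [hS_def, Finset.mem_filter, Finset.mem_univ, true_and]
  have hScm := model_mul_mem_iff e hc Φ φ₀ S hS
  have hv1 : (((1 : QuaternionGroup 2), Multiplicative.ofAdd (4 : ZMod p)) :
      QuaternionGroup 2 × Multiplicative (ZMod p)) ≠ 1 := by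
    intro h
    rw [Prod.mk_eq_one] at h
    have h4 : (4 : ZMod p) = 0 := by
      have := congrArg Multiplicative.toAdd h.2
      simpa using this
    rw [show (4 : ZMod p) = ((2 ^ 2 : ℕ) : ZMod p) by norm_num, ZMod.natCast_eq_zero_iff] at h4
    exact hp2 ((Nat.prime_dvd_prime_iff_eq hp Nat.prime_two).1 (hp.dvd_of_dvd_pow h4))
  have hstab : ¬ ∀ w : QuaternionGroup 2 × Multiplicative (ZMod p),
      w ∈ S ↔ ((1 : QuaternionGroup 2), Multiplicative.ofAdd (4 : ZMod p)) * w ∈ S :=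
    fun h => not_isPrimitive_of_leftStabiliser e Φ φ₀ S hS hv1 h hprim
  exact (isNondegenerate_iff_forall_annihilator e hc Φ φ₀ S hS).2 fun b hb hann =>
    eq_zero_of_annihilated_quaternion_cyclic_of_forall_normPair_const hp2 hNP S hScm hstab b hb hann

/-- **THE DICHOTOMY CRITERION for `Q₈ × C_p` (iff).**  For a Galois CM field `K` with `Gal(K/ℚ) ≅ Q₈ × C_p` (`p` an odd prime):
EVERY PRIMITIVE CM TYPE OF `K` IS NONDEGENERATE if and only if `ℤ/p` carries NO `μ₄`-norm pair of `Q₈ × C_p` with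
non-constant first sheet (⟸: the converse model theorem; ⟹: part II `exists_simple_degenerate_of_normPair`).  GOOD (theorem)
for `ord_p 2` odd; BAD (explicit pairs) for `p = 3, 5, 11, 13, 17, 19, 37, 43, 61`. [cite: Kubota1965, §2 and §4 Lemma 2]
[cite: Shimura1998, §8.2 Prop. 26] -/
theorem forall_isNondegenerate_iff_forall_normPair_const (hp2 : p ≠ 2)
    (e : (K ≃ₐ[ℚ] K) ≃* QuaternionGroup 2 × Multiplicative (ZMod p)) :
    (∀ (Φ : CMType K) (φ₀ : K →+* ℂ), IsPrimitive (ℂ ≃+* ℂ) Φ.1 φ₀ → IsNondegenerate Φ) ↔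
    (∀ k₀ k₁ : ZMod p → ZMod 4,
      (∀ d : ZMod p,
        (Finset.univ.filter fun v => k₀ v - k₀ (d - v) = 0).card +
              (Finset.univ.filter fun v => k₁ v - k₁ (d - v) = 0).card +
            (Finset.univ.filter fun v => k₀ v - k₀ (0 - v) = 2).card +
              (Finset.univ.filter fun v => k₁ v - k₁ (0 - v) = 2).card =
          (Finset.univ.filter fun v => k₀ v - k₀ (0 - v) = 0).card +
                (Finset.univ.filter fun v => k₁ v - k₁ (0 - v) = 0).card +
              (Finset.univ.filter fun v => k₀ v - k₀ (d - v) = 2).card +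
            (Finset.univ.filter fun v => k₁ v - k₁ (d - v) = 2).card) →
      (∀ d : ZMod p,
        (Finset.univ.filter fun v => k₀ v - k₀ (d - v) = 1).card +
              (Finset.univ.filter fun v => k₁ v - k₁ (d - v) = 1).card +
            (Finset.univ.filter fun v => k₀ v - k₀ (0 - v) = 3).card +
              (Finset.univ.filter fun v => k₁ v - k₁ (0 - v) = 3).card =
          (Finset.univ.filter fun v => k₀ v - k₀ (0 - v) = 1).card +
                (Finset.univ.filter fun v => k₁ v - k₁ (0 - v) = 1).card +
              (Finset.univ.filter fun v => k₀ v - k₀ (d - v) = 3).card +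
            (Finset.univ.filter fun v => k₁ v - k₁ (d - v) = 3).card) →
      ∀ v, k₀ v = k₀ 0) := by
  refine ⟨fun hall k₀ k₁ hR hI => ?_, fun hNP Φ φ₀ hprim =>
    isNondegenerate_of_isPrimitive_quaternion_cyclic_of_forall_normPair_const hp2 hNP e φ₀ hprim⟩
  by_contra hk
  push Not at hk
  obtain ⟨v, hv⟩ := hk
  obtain ⟨Φ, φ₀, A, ι, θ, hprim, hdeg, -⟩ := exists_simple_degenerate_of_normPair hp2 e k₀ k₁ ⟨v, hv⟩ hR hI
  exact hdeg (hall Φ φ₀ hprim)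

/-- The rank under the no-norm-pair hypothesis: `cmTypeRank Φ = 4p + 1`. [cite: Kubota1965, §2 (p. 115)] -/
theorem cmTypeRank_eq_of_isPrimitive_quaternion_cyclic_of_forall_normPair_const (hp2 : p ≠ 2)
    (hNP : ∀ k₀ k₁ : ZMod p → ZMod 4,
      (∀ d : ZMod p,
        (Finset.univ.filter fun v => k₀ v - k₀ (d - v) = 0).card +
              (Finset.univ.filter fun v => k₁ v - k₁ (d - v) = 0).card +
            (Finset.univ.filter fun v => k₀ v - k₀ (0 - v) = 2).card +
              (Finset.univ.filter fun v => k₁ v - k₁ (0 - v) = 2).card =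
          (Finset.univ.filter fun v => k₀ v - k₀ (0 - v) = 0).card +
                (Finset.univ.filter fun v => k₁ v - k₁ (0 - v) = 0).card +
              (Finset.univ.filter fun v => k₀ v - k₀ (d - v) = 2).card +
            (Finset.univ.filter fun v => k₁ v - k₁ (d - v) = 2).card) →
      (∀ d : ZMod p,
        (Finset.univ.filter fun v => k₀ v - k₀ (d - v) = 1).card +
              (Finset.univ.filter fun v => k₁ v - k₁ (d - v) = 1).card +
            (Finset.univ.filter fun v => k₀ v - k₀ (0 - v) = 3).card +
              (Finset.univ.filter fun v => k₁ v - k₁ (0 - v) = 3).card =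
          (Finset.univ.filter fun v => k₀ v - k₀ (0 - v) = 1).card +
                (Finset.univ.filter fun v => k₁ v - k₁ (0 - v) = 1).card +
              (Finset.univ.filter fun v => k₀ v - k₀ (d - v) = 3).card +
            (Finset.univ.filter fun v => k₁ v - k₁ (d - v) = 3).card) →
      ∀ v, k₀ v = k₀ 0)
    (e : (K ≃ₐ[ℚ] K) ≃* QuaternionGroup 2 × Multiplicative (ZMod p)) {Φ : CMType K} (φ₀ : K →+* ℂ)
    (hprim : IsPrimitive (ℂ ≃+* ℂ) Φ.1 φ₀) : cmTypeRank Φ = 4 * p + 1 := by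
  have h := isNondegenerate_of_isPrimitive_quaternion_cyclic_of_forall_normPair_const hp2 hNP e φ₀ hprim
  rw [isNondegenerate_iff, finrank_eq e] at h
  rw [h]; omega

end Field

/-! ## The Hodge conjecture for the simple CM abelian `4p`-folds and their powers, under the combinatorial hypothesis -/

section Geometry

variable {p : ℕ} [Fact p.Prime]
variable {K : Type} [Field K] [NumberField K] [IsCMField K] [IsGalois ℚ K]
variable {Φ : CMType K} {A : AbelianVariety ℂ} {ι : 𝓞 K →+* End A}
  {θ : K →+* Module.End ℂ (complexBetti A.X 1)}

/-- **THE HODGE CONJECTURE FOR EVERY POWER OF EVERY SIMPLE ABELIAN VARIETY (of dimension `4p`) WITH COMPLEX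
MULTIPLICATION BY A GALOIS CM FIELD WITH GROUP `Q₈ × C_p`, AS SOON AS `ℤ/p` HAS NO `μ₄`-NORM PAIR OF `Q₈ × C_p`** (a finite
check on `p`; e.g. every `p` with `ord_p 2` odd by part III). [cite: Gordon1999HodgeAVSurvey, Thm. 6.4]
[cite: Shimura1998, §8.2 Prop. 26] -/
theorem hodgeConjectureFor_pow_of_isSimple_quaternion_cyclic_of_forall_normPair_const (hp2 : p ≠ 2)
    (hNP : ∀ k₀ k₁ : ZMod p → ZMod 4,
      (∀ d : ZMod p,
        (Finset.univ.filter fun v => k₀ v - k₀ (d - v) = 0).card +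
              (Finset.univ.filter fun v => k₁ v - k₁ (d - v) = 0).card +
            (Finset.univ.filter fun v => k₀ v - k₀ (0 - v) = 2).card +
              (Finset.univ.filter fun v => k₁ v - k₁ (0 - v) = 2).card =
          (Finset.univ.filter fun v => k₀ v - k₀ (0 - v) = 0).card +
                (Finset.univ.filter fun v => k₁ v - k₁ (0 - v) = 0).card +
              (Finset.univ.filter fun v => k₀ v - k₀ (d - v) = 2).card +
            (Finset.univ.filter fun v => k₁ v - k₁ (d - v) = 2).card) →
      (∀ d : ZMod p,
        (Finset.univ.filter fun v => k₀ v - k₀ (d - v) = 1).card +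
              (Finset.univ.filter fun v => k₁ v - k₁ (d - v) = 1).card +
            (Finset.univ.filter fun v => k₀ v - k₀ (0 - v) = 3).card +
              (Finset.univ.filter fun v => k₁ v - k₁ (0 - v) = 3).card =
          (Finset.univ.filter fun v => k₀ v - k₀ (0 - v) = 1).card +
                (Finset.univ.filter fun v => k₁ v - k₁ (0 - v) = 1).card +
              (Finset.univ.filter fun v => k₀ v - k₀ (d - v) = 3).card +
            (Finset.univ.filter fun v => k₁ v - k₁ (d - v) = 3).card) →
      ∀ v, k₀ v = k₀ 0)
    (e : (K ≃ₐ[ℚ] K) ≃* QuaternionGroup 2 × Multiplicative (ZMod p)) (hA : IsCMTypeRealisation Φ A ι θ)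
    (hs : A.IsSimple) (N : ℕ) :
    HodgeConjectureFor (⨁ fun _ : Fin N => A).dim (⨁ fun _ : Fin N => A).X := by
  obtain ⟨φ₀⟩ := (inferInstance : Nonempty (K →+* ℂ))
  exact (isNondegenerate_of_isPrimitive_quaternion_cyclic_of_forall_normPair_const hp2 hNP e φ₀
    ((isSimple_iff_isPrimitive hA φ₀).1 hs)).hodgeConjectureFor_pow hA N

/-- The Hodge conjecture for the simple abelian variety itself. [cite: Gordon1999HodgeAVSurvey, Thm. 6.4] -/
theorem hodgeConjectureFor_of_isSimple_quaternion_cyclic_of_forall_normPair_const (hp2 : p ≠ 2)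
    (hNP : ∀ k₀ k₁ : ZMod p → ZMod 4,
      (∀ d : ZMod p,
        (Finset.univ.filter fun v => k₀ v - k₀ (d - v) = 0).card +
              (Finset.univ.filter fun v => k₁ v - k₁ (d - v) = 0).card +
            (Finset.univ.filter fun v => k₀ v - k₀ (0 - v) = 2).card +
              (Finset.univ.filter fun v => k₁ v - k₁ (0 - v) = 2).card =
          (Finset.univ.filter fun v => k₀ v - k₀ (0 - v) = 0).card +
                (Finset.univ.filter fun v => k₁ v - k₁ (0 - v) = 0).card +
              (Finset.univ.filter fun v => k₀ v - k₀ (d - v) = 2).card +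
            (Finset.univ.filter fun v => k₁ v - k₁ (d - v) = 2).card) →
      (∀ d : ZMod p,
        (Finset.univ.filter fun v => k₀ v - k₀ (d - v) = 1).card +
              (Finset.univ.filter fun v => k₁ v - k₁ (d - v) = 1).card +
            (Finset.univ.filter fun v => k₀ v - k₀ (0 - v) = 3).card +
              (Finset.univ.filter fun v => k₁ v - k₁ (0 - v) = 3).card =
          (Finset.univ.filter fun v => k₀ v - k₀ (0 - v) = 1).card +
                (Finset.univ.filter fun v => k₁ v - k₁ (0 - v) = 1).card +
              (Finset.univ.filter fun v => k₀ v - k₀ (d - v) = 3).card +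
            (Finset.univ.filter fun v => k₁ v - k₁ (d - v) = 3).card) →
      ∀ v, k₀ v = k₀ 0)
    (e : (K ≃ₐ[ℚ] K) ≃* QuaternionGroup 2 × Multiplicative (ZMod p)) (hA : IsCMTypeRealisation Φ A ι θ)
    (hs : A.IsSimple) : HodgeConjectureFor A.dim A.X := by
  obtain ⟨φ₀⟩ := (inferInstance : Nonempty (K →+* ℂ))
  exact (isNondegenerate_of_isPrimitive_quaternion_cyclic_of_forall_normPair_const hp2 hNP e φ₀
    ((isSimple_iff_isPrimitive hA φ₀).1 hs)).hodgeConjectureFor hA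

/-- `Bᵐ(Aⁿ) ⊗ ℂ = Dᵐ(Aⁿ) ⊗ ℂ` on every power of such a simple abelian variety. [cite: Gordon1999HodgeAVSurvey, §9.3] -/
theorem hodgeClassSpan_pow_eq_divisorClassesSpan_of_isSimple_quaternion_cyclic_of_forall_normPair_const (hp2 : p ≠ 2)
    (hNP : ∀ k₀ k₁ : ZMod p → ZMod 4,
      (∀ d : ZMod p,
        (Finset.univ.filter fun v => k₀ v - k₀ (d - v) = 0).card +
              (Finset.univ.filter fun v => k₁ v - k₁ (d - v) = 0).card +
            (Finset.univ.filter fun v => k₀ v - k₀ (0 - v) = 2).card +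
              (Finset.univ.filter fun v => k₁ v - k₁ (0 - v) = 2).card =
          (Finset.univ.filter fun v => k₀ v - k₀ (0 - v) = 0).card +
                (Finset.univ.filter fun v => k₁ v - k₁ (0 - v) = 0).card +
              (Finset.univ.filter fun v => k₀ v - k₀ (d - v) = 2).card +
            (Finset.univ.filter fun v => k₁ v - k₁ (d - v) = 2).card) →
      (∀ d : ZMod p,
        (Finset.univ.filter fun v => k₀ v - k₀ (d - v) = 1).card +
              (Finset.univ.filter fun v => k₁ v - k₁ (d - v) = 1).card +
            (Finset.univ.filter fun v => k₀ v - k₀ (0 - v) = 3).card +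
              (Finset.univ.filter fun v => k₁ v - k₁ (0 - v) = 3).card =
          (Finset.univ.filter fun v => k₀ v - k₀ (0 - v) = 1).card +
                (Finset.univ.filter fun v => k₁ v - k₁ (0 - v) = 1).card +
              (Finset.univ.filter fun v => k₀ v - k₀ (d - v) = 3).card +
            (Finset.univ.filter fun v => k₁ v - k₁ (d - v) = 3).card) →
      ∀ v, k₀ v = k₀ 0)
    (e : (K ≃ₐ[ℚ] K) ≃* QuaternionGroup 2 × Multiplicative (ZMod p)) (hA : IsCMTypeRealisation Φ A ι θ)
    (hs : A.IsSimple) (N m : ℕ) :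
    Literature.AlgebraicGeometry.VanGeemen1994.hodgeClassSpan (⨁ fun _ : Fin N => A).dim (⨁ fun _ : Fin N => A).X m =
      Literature.Barriers.HodgeConjecture.divisorClassesSpan (⨁ fun _ : Fin N => A).X
        (⨁ fun _ : Fin N => A).dim m := by
  obtain ⟨φ₀⟩ := (inferInstance : Nonempty (K →+* ℂ))
  exact (isNondegenerate_of_isPrimitive_quaternion_cyclic_of_forall_normPair_const hp2 hNP e φ₀
    ((isSimple_iff_isPrimitive hA φ₀).1 hs)).hodgeClassSpan_pow_eq_divisorClassesSpan hA N m

/-- **ALL TYPES under the no-norm-pair hypothesis** (part III♯ `CorCM/GaloisQuaternionCyclicPrimeAllTypes` fed with the iff):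
every complex abelian variety `X` with `K ↪ End⁰(X)`, `[K:ℚ] = 2 dim X`, is STABLY NONDEGENERATE.
[cite: Shimura1998, §5.1 Prop. 3, §8.2 Prop. 26] [cite: Gordon1999HodgeAVSurvey, Thm. 6.4 and Def. 7.6] -/
theorem isStablyNondegenerate_of_ringHom_quaternion_cyclic_of_forall_normPair_const (hp2 : p ≠ 2)
    (hNP : ∀ k₀ k₁ : ZMod p → ZMod 4,
      (∀ d : ZMod p,
        (Finset.univ.filter fun v => k₀ v - k₀ (d - v) = 0).card +
              (Finset.univ.filter fun v => k₁ v - k₁ (d - v) = 0).card +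
            (Finset.univ.filter fun v => k₀ v - k₀ (0 - v) = 2).card +
              (Finset.univ.filter fun v => k₁ v - k₁ (0 - v) = 2).card =
          (Finset.univ.filter fun v => k₀ v - k₀ (0 - v) = 0).card +
                (Finset.univ.filter fun v => k₁ v - k₁ (0 - v) = 0).card +
              (Finset.univ.filter fun v => k₀ v - k₀ (d - v) = 2).card +
            (Finset.univ.filter fun v => k₁ v - k₁ (d - v) = 2).card) →
      (∀ d : ZMod p,
        (Finset.univ.filter fun v => k₀ v - k₀ (d - v) = 1).card +
              (Finset.univ.filter fun v => k₁ v - k₁ (d - v) = 1).card +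
            (Finset.univ.filter fun v => k₀ v - k₀ (0 - v) = 3).card +
              (Finset.univ.filter fun v => k₁ v - k₁ (0 - v) = 3).card =
          (Finset.univ.filter fun v => k₀ v - k₀ (0 - v) = 1).card +
                (Finset.univ.filter fun v => k₁ v - k₁ (0 - v) = 1).card +
              (Finset.univ.filter fun v => k₀ v - k₀ (d - v) = 3).card +
            (Finset.univ.filter fun v => k₁ v - k₁ (d - v) = 3).card) →
      ∀ v, k₀ v = k₀ 0)
    (e : (K ≃ₐ[ℚ] K) ≃* QuaternionGroup 2 × Multiplicative (ZMod p))
    {X : AbelianVariety ℂ} (ψ : K →+* X.endAlgebra) (hX : Module.finrank ℚ K = 2 * X.dim) : IsStablyNondegenerate X :=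
  isStablyNondegenerate_of_ringHom_quaternion_cyclic_of_forall hp2 e
    (fun _ φ₀ hprim => isNondegenerate_of_isPrimitive_quaternion_cyclic_of_forall_normPair_const hp2 hNP e φ₀ hprim) ψ hX

/-- **THE HODGE CONJECTURE FOR EVERY POWER OF EVERY ABELIAN VARIETY (any CM type, simple or not) WITH CM BY A GALOIS CM
FIELD WITH GROUP `Q₈ × C_p`, AS SOON AS `ℤ/p` HAS NO `μ₄`-NORM PAIR OF `Q₈ × C_p`.** [cite: Gordon1999HodgeAVSurvey, Thm. 6.4]
[cite: Shimura1998, §5.1 Prop. 3 and §8.2 Prop. 26] -/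
theorem hodgeConjectureFor_pow_quaternion_cyclic_of_forall_normPair_const (hp2 : p ≠ 2)
    (hNP : ∀ k₀ k₁ : ZMod p → ZMod 4,
      (∀ d : ZMod p,
        (Finset.univ.filter fun v => k₀ v - k₀ (d - v) = 0).card +
              (Finset.univ.filter fun v => k₁ v - k₁ (d - v) = 0).card +
            (Finset.univ.filter fun v => k₀ v - k₀ (0 - v) = 2).card +
              (Finset.univ.filter fun v => k₁ v - k₁ (0 - v) = 2).card =
          (Finset.univ.filter fun v => k₀ v - k₀ (0 - v) = 0).card +
                (Finset.univ.filter fun v => k₁ v - k₁ (0 - v) = 0).card +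
              (Finset.univ.filter fun v => k₀ v - k₀ (d - v) = 2).card +
            (Finset.univ.filter fun v => k₁ v - k₁ (d - v) = 2).card) →
      (∀ d : ZMod p,
        (Finset.univ.filter fun v => k₀ v - k₀ (d - v) = 1).card +
              (Finset.univ.filter fun v => k₁ v - k₁ (d - v) = 1).card +
            (Finset.univ.filter fun v => k₀ v - k₀ (0 - v) = 3).card +
              (Finset.univ.filter fun v => k₁ v - k₁ (0 - v) = 3).card =
          (Finset.univ.filter fun v => k₀ v - k₀ (0 - v) = 1).card +
                (Finset.univ.filter fun v => k₁ v - k₁ (0 - v) = 1).card +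
              (Finset.univ.filter fun v => k₀ v - k₀ (d - v) = 3).card +
            (Finset.univ.filter fun v => k₁ v - k₁ (d - v) = 3).card) →
      ∀ v, k₀ v = k₀ 0)
    (e : (K ≃ₐ[ℚ] K) ≃* QuaternionGroup 2 × Multiplicative (ZMod p)) (hA : IsCMTypeRealisation Φ A ι θ) (N : ℕ) :
    HodgeConjectureFor (⨁ fun _ : Fin N => A).dim (⨁ fun _ : Fin N => A).X := by
  obtain ⟨i, -⟩ := exists_ringHom_endAlgebra ι
  exact hodgeConjectureFor_of_isDivisorGenerated _
    ((isStablyNondegenerate_iff_forall_isDivisorGenerated_biproduct A).1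
      (isStablyNondegenerate_of_ringHom_quaternion_cyclic_of_forall_normPair_const hp2 hNP e i
        (finrank_eq_two_mul_dim_of_isCMTypeRealisation hA)) N)

/-- **… and conversely the norm-pair obstruction is genuinely absent when `ord_p 2` is odd**: for such `p` (part III: GOOD)
`ℤ/p` carries no `μ₄`-norm pair of `Q₈ × C_p` with non-constant first sheet (given any Galois CM field with this group).
[cite: Kubota1965, §4 Lemma 2] -/
theorem forall_normPair_const_of_odd_orderOf_two (hodd : Odd (orderOf (2 : ZMod p)))
    (e : (K ≃ₐ[ℚ] K) ≃* QuaternionGroup 2 × Multiplicative (ZMod p)) (k₀ k₁ : ZMod p → ZMod 4)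
    (hR : ∀ d : ZMod p,
      (Finset.univ.filter fun v => k₀ v - k₀ (d - v) = 0).card +
            (Finset.univ.filter fun v => k₁ v - k₁ (d - v) = 0).card +
          (Finset.univ.filter fun v => k₀ v - k₀ (0 - v) = 2).card + (Finset.univ.filter fun v => k₁ v - k₁ (0 - v) = 2).card =
        (Finset.univ.filter fun v => k₀ v - k₀ (0 - v) = 0).card + (Finset.univ.filter fun v => k₁ v - k₁ (0 - v) = 0).card +
            (Finset.univ.filter fun v => k₀ v - k₀ (d - v) = 2).card +
          (Finset.univ.filter fun v => k₁ v - k₁ (d - v) = 2).card)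
    (hI : ∀ d : ZMod p,
      (Finset.univ.filter fun v => k₀ v - k₀ (d - v) = 1).card +
            (Finset.univ.filter fun v => k₁ v - k₁ (d - v) = 1).card +
          (Finset.univ.filter fun v => k₀ v - k₀ (0 - v) = 3).card + (Finset.univ.filter fun v => k₁ v - k₁ (0 - v) = 3).card =
        (Finset.univ.filter fun v => k₀ v - k₀ (0 - v) = 1).card + (Finset.univ.filter fun v => k₁ v - k₁ (0 - v) = 1).card +
            (Finset.univ.filter fun v => k₀ v - k₀ (d - v) = 3).card +
          (Finset.univ.filter fun v => k₁ v - k₁ (d - v) = 3).card) :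
    ∀ v, k₀ v = k₀ 0 :=
  (forall_isNondegenerate_iff_forall_normPair_const (ne_two_of_odd_orderOf_two hodd) e).1
    (fun _ φ₀ hprim => isNondegenerate_of_isPrimitive_of_odd_orderOf_two hodd e φ₀ hprim) k₀ k₁ hR hI

end Geometry

end Summit.HodgeConjecture.CorCM.GaloisQuaternionCyclic

end
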